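import Literature.MathematicalPhysics.QuantumLattice.SchwartzTranslationCutoff
import Literature.MathematicalPhysics.AQFT.OffDiagonalFlatDecay
import Literature.MathematicalPhysics.AQFT.OSAxiomsSchwinger
import Literature.MathematicalPhysics.QuantumLattice.SchwartzTensor
import Literature.MathematicalPhysics.QuantumLattice.RandomField
import HarnessLib

/-!
# `PencilRigidity.NPointIsotropy`, line `complex-rotation-bandlimit`: `⁰𝒮` is the closed span of off-diagonal real product tensors (assembly)

Stub `offDiagDensity` of crux `stmt-QuantumFields-11686`
(`Summit.QuantumFields.YangMills.Theses.PencilRigidity.NPointIsotropy`), line `complex-rotation-bandlimit`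
(lead c1, gen 5, wave 2), proved over the tree as it is (nothing is posited, no named fact is used).

Write `X = (ℝ⁴)ⁿ = Fin n → EuclideanSpace ℝ (Fin 4)`, `A ⊆ X` for the coincidence locus
(`Literature.MathematicalPhysics.AQFT.coincidenceLocus`, some `xᵢ = xⱼ`, `i ≠ j`), `⁰𝒮 ⊆ 𝓢(X, ℂ)` for the
Schwartz functions flat on `A` (`IsOffDiagonal`) and
`𝒞 := closure (span_ℂ {P | P = f₁ ⊗ ⋯ ⊗ fₙ with real Schwartz fᵢ on ℝ⁴, P ∈ ⁰𝒮})`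
for the closed `ℂ`-span of the off-diagonal real product tensors.

**Statement (implication form, as registered).** Assume
* (H1) for every `n` a smooth cut-off family `ψ_k : X → [0, 1]` with `ψ_k = 1` where all mutual
  distances are `≥ 2/(k+1)`, `ψ_k = 0` where some mutual distance is `≤ 1/(k+1)`, and
  `‖Dˡ ψ_k‖ ≤ C_l (k+1)ˡ`;
* (H2) for every such family (properties 1, 2, 3, 5) and every `F ∈ ⁰𝒮`, the products `u_k = ψ_k F` are
  Schwartz and `u_k → F` in `𝓢`;
* (H3) every compactly supported `G ∈ 𝓢(X, ℂ)` with `tsupport G ⊆ Aᶜ` lies in `𝒞`.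
Then `⁰𝒮 ⊆ 𝒞`: every `F ∈ ⁰𝒮` lies in `𝒞`.

**Proof.** Fix `n`, `F`; take `C, ψ` from (H1) and `u` from (H2). `𝒞` is closed, so it suffices that
every `u_k ∈ 𝒞` (`IsClosed.mem_of_tendsto`). Cut `u_k` off inside its support
(`exists_tsupport_subset_inter_closedBall_tendsto`): `v_m → u_k` with
`tsupport v_m ⊆ tsupport u_k ∩ closedBall 0 (2(m+1))`, so `v_m` is compactly supported and
`tsupport v_m ⊆ tsupport u_k ⊆ Aᶜ`; the last inclusion holds because `u_k` vanishes on the closed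
neighbourhood `{x | ∃ i ≠ j, ‖xᵢ - xⱼ‖ ≤ 1/(k+1)}` of `A` (property 4 of the family), so
`support u_k ⊆ {x | ∀ i ≠ j, 1/(k+1) ≤ ‖xᵢ - xⱼ‖}`, a closed set disjoint from `A`, whence so is
`tsupport u_k` (`closure_minimal`). By (H3) `v_m ∈ 𝒞`, hence `u_k ∈ 𝒞`, hence `F ∈ 𝒞`.

**Corollary (functional form).** A continuous linear functional on `𝓢(X, ℂ)` killing every
off-diagonal real product tensor kills `⁰𝒮` (its kernel is a closed submodule containing the
generators): `offDiagDensity_functional_of_density` (from the density conclusion) and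
`offDiagDensity_functional` (from (H1)–(H3)).

References: folklore (closedness of spans/kernels; `C_c^∞` cut-offs in `𝒮`, Hörmander I, Lemma 7.1.8).
[folklore]
-/

noncomputable section

open Filter Topology Set Metric
open Literature.MathematicalPhysics.QuantumLattice Literature.MathematicalPhysics.AQFT

namespace Summit.QuantumFields.YangMills.Theorems.NPointIsotropy.ComplexRotationBandlimit

/-! ## Supports separated from the coincidence locus -/

/-- The configurations all of whose mutual distances are at least `r`,
`{x : Eⁿ | ∀ i ≠ j, r ≤ ‖xᵢ - xⱼ‖}`, form a closed set (a finite intersection of preimages of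
`[r, ∞)` under the continuous maps `x ↦ ‖xᵢ - xⱼ‖`). [folklore] -/
theorem isClosed_setOf_forall_le_norm_sub {E : Type*} [NormedAddCommGroup E] (n : ℕ) (r : ℝ) :
    IsClosed {x : Fin n → E | ∀ i j : Fin n, i ≠ j → r ≤ ‖x i - x j‖} := by
  simp only [Set.setOf_forall]
  exact isClosed_iInter fun i => isClosed_iInter fun j => isClosed_iInter fun _ =>
    isClosed_le continuous_const ((continuous_apply i).sub (continuous_apply j)).norm

/-- The set `{x : Eⁿ | ∀ i ≠ j, r ≤ ‖xᵢ - xⱼ‖}` with `0 < r` is disjoint from the coincidence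
locus (on the locus some `xᵢ = xⱼ`, at distance `0 < r`). [folklore] -/
theorem setOf_forall_le_norm_sub_subset_compl_coincidenceLocus {E : Type*} [NormedAddCommGroup E]
    (n : ℕ) {r : ℝ} (hr : 0 < r) :
    {x : Fin n → E | ∀ i j : Fin n, i ≠ j → r ≤ ‖x i - x j‖} ⊆ (coincidenceLocus n E)ᶜ := by
  rintro x hx ⟨i, j, hij, hEq⟩
  have h := hx i j hij
  rw [hEq, sub_self, norm_zero] at h
  exact absurd h (not_le.mpr hr)

/-- **A function vanishing near the diagonals is supported off the coincidence locus.** If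
`g : Eⁿ → ℂ` vanishes at every `x` with some mutual distance `‖xᵢ - xⱼ‖ ≤ r` (`i ≠ j`, `0 < r`),
then `tsupport g ⊆ (coincidenceLocus n E)ᶜ`: the support lies in the closed set
`{∀ i ≠ j, r ≤ ‖xᵢ - xⱼ‖}`, hence so does its closure, and that set misses the locus. [folklore] -/
theorem tsupport_subset_compl_coincidenceLocus {E : Type*} [NormedAddCommGroup E] {n : ℕ} {r : ℝ}
    (hr : 0 < r) {g : (Fin n → E) → ℂ}
    (hg : ∀ x : Fin n → E, (∃ i j : Fin n, i ≠ j ∧ ‖x i - x j‖ ≤ r) → g x = 0) :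
    tsupport g ⊆ (coincidenceLocus n E)ᶜ := by
  refine Set.Subset.trans ?_ (setOf_forall_le_norm_sub_subset_compl_coincidenceLocus n hr)
  refine closure_minimal (fun y hy => ?_) (isClosed_setOf_forall_le_norm_sub n r)
  simp only [Set.mem_setOf_eq]
  intro i j hij
  by_contra hlt
  exact hy (hg y ⟨i, j, hij, (not_le.mp hlt).le⟩)

/-- **The cut-off products are supported off the coincidence locus.** If `ψ : X → ℝ` vanishes
wherever some mutual distance is `≤ 1/(k+1)` and `u x = ψ x · F x`, then
`tsupport u ⊆ (coincidenceLocus n E)ᶜ`. [folklore] -/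
theorem tsupport_cutoff_mul_subset_compl_coincidenceLocus {E : Type*} [NormedAddCommGroup E] {n : ℕ}
    (k : ℕ) {ψ : (Fin n → E) → ℝ} {F u : (Fin n → E) → ℂ}
    (hψ : ∀ x : Fin n → E, (∃ i j : Fin n, i ≠ j ∧ ‖x i - x j‖ ≤ 1 / ((k : ℝ) + 1)) → ψ x = 0)
    (hu : ∀ x : Fin n → E, u x = (ψ x : ℂ) * F x) :
    tsupport u ⊆ (coincidenceLocus n E)ᶜ := by
  have hr : (0 : ℝ) < 1 / ((k : ℝ) + 1) := by positivity
  exact tsupport_subset_compl_coincidenceLocus hr fun x hx => by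
    rw [hu x, hψ x hx, Complex.ofReal_zero, zero_mul]

/-! ## Closed spans and limits -/

/-- A Schwartz function all of whose inner compact cut-offs (supported inside its own support and
compactly supported) lie in a closed set `𝒞` lies in `𝒞` itself: the cut-offs of
`exists_tsupport_subset_inter_closedBall_tendsto` converge to it. [folklore] -/
theorem mem_of_isClosed_of_cutoffs {X : Type*} [NormedAddCommGroup X] [NormedSpace ℝ X]
    [FiniteDimensional ℝ X] {𝒞 : Set (SchwartzMap X ℂ)} (h𝒞 : IsClosed 𝒞) (u : SchwartzMap X ℂ)
    (h : ∀ v : SchwartzMap X ℂ, HasCompactSupport (v : X → ℂ) →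
      tsupport (v : X → ℂ) ⊆ tsupport (u : X → ℂ) → v ∈ 𝒞) :
    u ∈ 𝒞 := by
  obtain ⟨v, hv, hvlim⟩ := exists_tsupport_subset_inter_closedBall_tendsto u
  refine h𝒞.mem_of_tendsto hvlim (Eventually.of_forall fun m => h (v m) ?_ ?_)
  · exact IsCompact.of_isClosed_subset (isCompact_closedBall _ _) (isClosed_tsupport _)
      ((hv m).trans Set.inter_subset_right)
  · exact (hv m).trans Set.inter_subset_left

/-! ## The registered stub -/

/-- **`⁰𝒮` is the closed span of the off-diagonal real product tensors (assembly).** Given (H1) a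
smooth cut-off family `ψ_k` (`= 1` at mutual distances `≥ 2/(k+1)`, `= 0` at some mutual distance
`≤ 1/(k+1)`, derivative bounds `C_l (k+1)ˡ`), (H2) the Schwartz convergence `ψ_k F → F` for flat `F`,
and (H3) the local density (compactly supported `G` with `tsupport G` off the coincidence locus lies
in the closed span `𝒞`), every `F ∈ ⁰𝒮` lies in `𝒞`: `𝒞` is closed, `u_k = ψ_k F → F`, and each
`u_k ∈ 𝒞` because its inner compact cut-offs are compactly supported inside
`tsupport u_k ⊆ (coincidenceLocus)ᶜ` and so lie in `𝒞` by (H3). Registered helper stub of line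
`complex-rotation-bandlimit` of crux `stmt-QuantumFields-11686`, stated byte-for-byte as registered.
[folklore] -/
theorem offDiagDensity : (∀ (n : ℕ), ∃ (C : ℕ → ℝ) (ψ : ℕ → (Fin n → EuclideanSpace ℝ (Fin 4)) → ℝ), (∀ k : ℕ, ContDiff ℝ (⊤ : ℕ∞) (ψ k)) ∧ (∀ (k : ℕ) (x : (Fin n → EuclideanSpace ℝ (Fin 4))), ψ k x ∈ Set.Icc (0 : ℝ) 1) ∧ (∀ (k : ℕ) (x : (Fin n → EuclideanSpace ℝ (Fin 4))), (∀ i j : Fin n, i ≠ j → 2 / ((k : ℝ) + 1) ≤ ‖x i - x j‖) → ψ k x = 1) ∧ (∀ (k : ℕ) (x : (Fin n → EuclideanSpace ℝ (Fin 4))), (∃ i j : Fin n, i ≠ j ∧ ‖x i - x j‖ ≤ 1 / ((k : ℝ) + 1)) → ψ k x = 0) ∧ (∀ (k l : ℕ) (x : (Fin n → EuclideanSpace ℝ (Fin 4))), ‖iteratedFDeriv ℝ l (ψ k) x‖ ≤ C l * ((k : ℝ) + 1) ^ l)) → (∀ (n : ℕ) (C : ℕ → ℝ) (ψ : ℕ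 → (Fin n → EuclideanSpace ℝ (Fin 4)) → ℝ), (∀ k : ℕ, ContDiff ℝ (⊤ : ℕ∞) (ψ k)) → (∀ (k : ℕ) (x : (Fin n → EuclideanSpace ℝ (Fin 4))), ψ k x ∈ Set.Icc (0 : ℝ) 1) → (∀ (k : ℕ) (x : (Fin n → EuclideanSpace ℝ (Fin 4))), (∀ i j : Fin n, i ≠ j → 2 / ((k : ℝ) + 1) ≤ ‖x i - x j‖) → ψ k x = 1) → (∀ (k l : ℕ) (x : (Fin n → EuclideanSpace ℝ (Fin 4))), ‖iteratedFDeriv ℝ l (ψ k) x‖ ≤ C l * ((k : ℝ) + 1) ^ l) → ∀ F : SchwartzMap (Fin n → EuclideanSpace ℝ (Fin 4)) ℂ, Literature.MathematicalPhysics.AQFT.IsOffDiagonal F → ∃ u : ℕ → SchwartzMap (Fin n → EuclideanSpace ℝ (Fin 4)) ℂ, (∀ (k : ℕ) (x : (Fin n → EuclideanSpace ℝ (Fin 4))), u k x = (ψ k x : ℂ) * F x) ∧ Filter.Tendsto u Filter.atTop (nhds F)) → (∀ (n : ℕ) (G : SchwartzMap (Fin n → EuclideanSpace ℝ (Fin 4))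 ℂ), HasCompactSupport (G : (Fin n → EuclideanSpace ℝ (Fin 4)) → ℂ) → tsupport (G : (Fin n → EuclideanSpace ℝ (Fin 4)) → ℂ) ⊆ (Literature.MathematicalPhysics.AQFT.coincidenceLocus n (EuclideanSpace ℝ (Fin 4)))ᶜ → G ∈ closure (Submodule.span ℂ {P : SchwartzMap (Fin n → EuclideanSpace ℝ (Fin 4)) ℂ | ∃ f : Fin n → SchwartzMap (EuclideanSpace ℝ (Fin 4)) ℝ, Literature.MathematicalPhysics.QuantumLattice.IsTensorOf P (fun i => Literature.MathematicalPhysics.QuantumLattice.ofRealTest (f i)) ∧ Literature.MathematicalPhysics.AQFT.IsOffDiagonal P} : Set (SchwartzMap (Fin n → EuclideanSpace ℝ (Fin 4)) ℂ))) → ∀ (n : ℕ) (F : SchwartzMap (Fin n → EuclideanSpace ℝ (Fin 4)) ℂ), Literature.MathematicalPhysics.AQFT.IsOffDiagonal F → F ∈ closure (Submodule.span ℂ {P : SchwartzMap (Fin n → EuclideanSpace ℝ (Fin 4)) ℂ | ∃ f : Fin n → SchwartzMap (EuclideanSpace ℝ (Fin 4)) ℝ, Literature.MathematicalPhysics.QuantumLattice.IsTensorOf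 P (fun i => Literature.MathematicalPhysics.QuantumLattice.ofRealTest (f i)) ∧ Literature.MathematicalPhysics.AQFT.IsOffDiagonal P} : Set (SchwartzMap (Fin n → EuclideanSpace ℝ (Fin 4)) ℂ)) := by
  intro hfam htend hloc n F hF
  obtain ⟨C, ψ, hsmooth, h01, hone, hzero, hbound⟩ := hfam n
  obtain ⟨u, hu, hlim⟩ := htend n C ψ hsmooth h01 hone hbound F hF
  refine isClosed_closure.mem_of_tendsto hlim (Eventually.of_forall fun k => ?_)
  refine mem_of_isClosed_of_cutoffs isClosed_closure (u k) fun v hvc hvs => hloc n v hvc ?_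
  exact hvs.trans (tsupport_cutoff_mul_subset_compl_coincidenceLocus k (hzero k) (hu k))

/-! ## Functional form -/

/-- **Functional form of the density, from the density conclusion.** If every `F ∈ ⁰𝒮` lies in the
closed `ℂ`-span `𝒞` of the off-diagonal real product tensors, then a continuous linear functional
`T` on `𝓢((ℝ⁴)ⁿ, ℂ)` vanishing on every off-diagonal real product tensor vanishes on `⁰𝒮`: the kernel
of `T` is a closed submodule (`ContinuousLinearMap.isClosed_ker`) containing the generators, hence
the span (`Submodule.span_le`), hence its closure (`closure_minimal`). [folklore] -/
theorem offDiagDensity_functional_of_density : (∀ (n : ℕ) (F : SchwartzMap (Fin n → EuclideanSpace ℝ (Fin 4)) ℂ), Literature.MathematicalPhysics.AQFT.IsOffDiagonal F → F ∈ closure (Submodule.span ℂ {P : SchwartzMap (Fin n → EuclideanSpace ℝ (Fin 4)) ℂ | ∃ f : Fin n → SchwartzMap (EuclideanSpace ℝ (Fin 4)) ℝ, Literature.MathematicalPhysics.QuantumLattice.IsTensorOf P (fun i => Literature.MathematicalPhysics.QuantumLattice.ofRealTest (f i)) ∧ Literature.MathematicalPhysics.AQFT.IsOffDiagonal P} : Set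 (SchwartzMap (Fin n → EuclideanSpace ℝ (Fin 4)) ℂ))) → ∀ (n : ℕ) (T : SchwartzMap (Fin n → EuclideanSpace ℝ (Fin 4)) ℂ →L[ℂ] ℂ), (∀ (f : Fin n → SchwartzMap (EuclideanSpace ℝ (Fin 4)) ℝ) (P : SchwartzMap (Fin n → EuclideanSpace ℝ (Fin 4)) ℂ), Literature.MathematicalPhysics.QuantumLattice.IsTensorOf P (fun i => Literature.MathematicalPhysics.QuantumLattice.ofRealTest (f i)) → Literature.MathematicalPhysics.AQFT.IsOffDiagonal P → T P = 0) → ∀ F : SchwartzMap (Fin n → EuclideanSpace ℝ (Fin 4)) ℂ, Literature.MathematicalPhysics.AQFT.IsOffDiagonal F → T F = 0 := by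
  intro hdense n T hT F hF
  have hsub : (Submodule.span ℂ {P : SchwartzMap (Fin n → EuclideanSpace ℝ (Fin 4)) ℂ |
      ∃ f : Fin n → SchwartzMap (EuclideanSpace ℝ (Fin 4)) ℝ,
        IsTensorOf P (fun i => ofRealTest (f i)) ∧ IsOffDiagonal P} :
        Set (SchwartzMap (Fin n → EuclideanSpace ℝ (Fin 4)) ℂ)) ⊆
      (LinearMap.ker (T : SchwartzMap (Fin n → EuclideanSpace ℝ (Fin 4)) ℂ →ₗ[ℂ] ℂ) :
        Set (SchwartzMap (Fin n → EuclideanSpace ℝ (Fin 4)) ℂ)) := by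
    refine SetLike.coe_subset_coe.mpr (Submodule.span_le.mpr ?_)
    rintro P ⟨f, hP, hPoff⟩
    exact LinearMap.mem_ker.mpr (hT f P hP hPoff)
  have hmem := closure_minimal hsub T.isClosed_ker (hdense n F hF)
  exact LinearMap.mem_ker.mp hmem

/-- **Functional form of the density, from (H1)–(H3).** Under the cut-off family (H1), the cut-off
convergence (H2) and the local density (H3), a continuous linear functional on `𝓢((ℝ⁴)ⁿ, ℂ)`
vanishing on every off-diagonal real product tensor `f₁ ⊗ ⋯ ⊗ fₙ` (`fᵢ` real Schwartz on `ℝ⁴`)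
vanishes on all of `⁰𝒮`. [folklore] -/
theorem offDiagDensity_functional : (∀ (n : ℕ), ∃ (C : ℕ → ℝ) (ψ : ℕ → (Fin n → EuclideanSpace ℝ (Fin 4)) → ℝ), (∀ k : ℕ, ContDiff ℝ (⊤ : ℕ∞) (ψ k)) ∧ (∀ (k : ℕ) (x : (Fin n → EuclideanSpace ℝ (Fin 4))), ψ k x ∈ Set.Icc (0 : ℝ) 1) ∧ (∀ (k : ℕ) (x : (Fin n → EuclideanSpace ℝ (Fin 4))), (∀ i j : Fin n, i ≠ j → 2 / ((k : ℝ) + 1) ≤ ‖x i - x j‖) → ψ k x = 1) ∧ (∀ (k : ℕ) (x : (Fin n → EuclideanSpace ℝ (Fin 4))), (∃ i j : Fin n, i ≠ j ∧ ‖x i - x j‖ ≤ 1 / ((k : ℝ) + 1)) → ψ k x = 0) ∧ (∀ (k l : ℕ) (x : (Fin n → EuclideanSpace ℝ (Fin 4))), ‖iteratedFDeriv ℝ l (ψ k) x‖ ≤ C l * ((k : ℝ) + 1) ^ l)) → (∀ (n : ℕ) (C : ℕ → ℝ) (ψ : ℕ → (Fin n → EuclideanSpace ℝ (Fin 4)) →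 ℝ), (∀ k : ℕ, ContDiff ℝ (⊤ : ℕ∞) (ψ k)) → (∀ (k : ℕ) (x : (Fin n → EuclideanSpace ℝ (Fin 4))), ψ k x ∈ Set.Icc (0 : ℝ) 1) → (∀ (k : ℕ) (x : (Fin n → EuclideanSpace ℝ (Fin 4))), (∀ i j : Fin n, i ≠ j → 2 / ((k : ℝ) + 1) ≤ ‖x i - x j‖) → ψ k x = 1) → (∀ (k l : ℕ) (x : (Fin n → EuclideanSpace ℝ (Fin 4))), ‖iteratedFDeriv ℝ l (ψ k) x‖ ≤ C l * ((k : ℝ) + 1) ^ l) → ∀ F : SchwartzMap (Fin n → EuclideanSpace ℝ (Fin 4)) ℂ, Literature.MathematicalPhysics.AQFT.IsOffDiagonal F → ∃ u : ℕ → SchwartzMap (Fin n → EuclideanSpace ℝ (Fin 4)) ℂ, (∀ (k : ℕ) (x : (Fin n → EuclideanSpace ℝ (Fin 4))), u k x = (ψ k x : ℂ) * F x) ∧ Filter.Tendsto u Filter.atTop (nhds F)) → (∀ (n : ℕ) (G : SchwartzMap (Fin n → EuclideanSpace ℝ (Fin 4)) ℂ), HasCompactSupport (G : (Fin n → EuclideanSpace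 ℝ (Fin 4)) → ℂ) → tsupport (G : (Fin n → EuclideanSpace ℝ (Fin 4)) → ℂ) ⊆ (Literature.MathematicalPhysics.AQFT.coincidenceLocus n (EuclideanSpace ℝ (Fin 4)))ᶜ → G ∈ closure (Submodule.span ℂ {P : SchwartzMap (Fin n → EuclideanSpace ℝ (Fin 4)) ℂ | ∃ f : Fin n → SchwartzMap (EuclideanSpace ℝ (Fin 4)) ℝ, Literature.MathematicalPhysics.QuantumLattice.IsTensorOf P (fun i => Literature.MathematicalPhysics.QuantumLattice.ofRealTest (f i)) ∧ Literature.MathematicalPhysics.AQFT.IsOffDiagonal P} : Set (SchwartzMap (Fin n → EuclideanSpace ℝ (Fin 4)) ℂ))) → ∀ (n : ℕ) (T : SchwartzMap (Fin n → EuclideanSpace ℝ (Fin 4)) ℂ →L[ℂ] ℂ), (∀ (f : Fin n → SchwartzMap (EuclideanSpace ℝ (Fin 4)) ℝ) (P : SchwartzMap (Fin n → EuclideanSpace ℝ (Fin 4)) ℂ), Literature.MathematicalPhysics.QuantumLattice.IsTensorOf P (fun i => Literature.MathematicalPhysics.QuantumLattice.ofRealTest (f i)) → Literature.MathematicalPhysics.AQFT.IsOffDiagonal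 P → T P = 0) → ∀ F : SchwartzMap (Fin n → EuclideanSpace ℝ (Fin 4)) ℂ, Literature.MathematicalPhysics.AQFT.IsOffDiagonal F → T F = 0 :=
  fun hfam htend hloc => offDiagDensity_functional_of_density (offDiagDensity hfam htend hloc)

end Summit.QuantumFields.YangMills.Theorems.NPointIsotropy.ComplexRotationBandlimit

end
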